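import Literature.Topology.FourManifolds.TautFoliationsNovikovProofs
import Literature.Topology.FourManifolds.SliceGenusUnknotLeaves
import HarnessLib

/-!
# Property R (Gabai 1987): the decomposition into Gabai's Corollary 8.2 and Novikov's theorem

Topic `Literature/Topology/FourManifolds`. SPLIT (assembly only — both children are EXISTING named
facts of the tree, no new named fact is introduced) of
`Literature.Topology.FourManifolds.isUnknot_of_isIntegralSurgery_zero` (`SurgeryGluck.lean`,
`spc4.S25`: if `0`-surgery on a knot `K ⊆ S³` is `S² × S¹` then `K` is the unknot — D. Gabai,
*Foliations and the topology of 3-manifolds III*, J. Differential Geom. 26 (1987), Cor. 8.3 with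
Remark 8.5, the Property R theorem).  The printed proof of Cor. 8.3 ("apply the work of Novikov,
Reeb, and Alexander to the conclusions of Corollary 8.2") followed by Remark 8.5 is formalised in
`TautFoliations.lean`, `TautFoliationsNovikov.lean`, `TautFoliationsNovikovProofs.lean`
(`isUnknot_of_isIntegralSurgery_zero_of_novikov'`: Property R from three named facts).  Of those
three, "genus `0` iff unknot" is now a THEOREM (`Knot.genus_eq_zero_iff_isUnknot_holds`,
`SliceGenusUnknotLeaves.lean`: Seifert's theorem `Knot.exists_hasSeifertSurfaceOfGenus_holds` and "a
knot bounding a disc is trivial"), so the fact rests on exactly two named facts, the children of this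
decomposition:

* `Literature.Topology.FourManifolds.Knot.exists_isTaut_hasCompactLeafOfGenus_of_isIntegralSurgery_zero`
  (`TautFoliations.lean`) — Gabai (1987), Cor. 8.2: zero frame surgery on a knot of Seifert genus
  `g` carries a transversely oriented taut `C⁰` foliation with a compact leaf of genus `g` (sutured
  manifold hierarchies, Gabai's Thm. 3.1; its slice `g = 0` is proved,
  `TautFoliationsGenusZero.lean`);
* `Literature.Topology.FourManifolds.Foliation.fundamentalGroup_map_injective_of_isTaut`
  (`TautFoliationsNovikov.lean`) — Novikov's theorem in the form of Gabai (1983), Thm. 2.8 (4):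
  compact leaves of transversely oriented taut `C⁰` foliations of closed oriented 3-manifolds are
  `π₁`-injective (Novikov 1965; `C⁰`: Solodov 1982, Bowden 2016, Thm. 2.7);

* `isUnknot_of_isIntegralSurgery_zero_holds_of` — the PROVED assembly (`π₁(S² × S¹)` cyclic, the
  proved Hurewicz theorem, and `genus_eq_zero_iff_isUnknot_holds`).

## References

* D. Gabai, *Foliations and the topology of 3-manifolds. III*, J. Differential Geom. 26 (1987)
  479–536: Thm. 3.1, Cor. 8.2, Cor. 8.3, Remark 8.5. [GabaiJDG1987]
* D. Gabai, *Foliations and the topology of 3-manifolds*, J. Differential Geom. 18 (1983) 445–503: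
  Thm. 2.8 (4), Def. 2.11. [Gabai1983]
-/

open scoped Manifold ContDiff Topology

noncomputable section

namespace Literature.Topology.FourManifolds

variable [SphereEmbedding.SmoothnessFacts] in
/-- **Property R from Gabai's Corollary 8.2 and Novikov's theorem (SPLIT assembly).**  Gabai
(1987), Cor. 8.2 (`Knot.exists_isTaut_hasCompactLeafOfGenus_of_isIntegralSurgery_zero`) and the
`π₁`-injectivity of compact leaves of taut foliations
(`Foliation.fundamentalGroup_map_injective_of_isTaut`, Gabai (1983), Thm. 2.8 (4)) imply
`isUnknot_of_isIntegralSurgery_zero`: by `isUnknot_of_isIntegralSurgery_zero_of_novikov'` with its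
third hypothesis "genus `0` iff unknot" discharged by `Knot.genus_eq_zero_iff_isUnknot_holds`.
This is the printed deduction Cor. 8.2 ⇒ Cor. 8.3 ⇒ Remark 8.5 for `M = S² × S¹`.
[cite: GabaiJDG1987, Cor. 8.2, Cor. 8.3 and Remark 8.5] [cite: Gabai1983, Thm. 2.8 (4)] -/
theorem isUnknot_of_isIntegralSurgery_zero_holds_of
    (h₁ : Knot.exists_isTaut_hasCompactLeafOfGenus_of_isIntegralSurgery_zero.{0})
    (h₂ : Foliation.fundamentalGroup_map_injective_of_isTaut.{0}) :
    FourManifolds.isUnknot_of_isIntegralSurgery_zero :=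
  isUnknot_of_isIntegralSurgery_zero_of_novikov' h₂ h₁ Knot.genus_eq_zero_iff_isUnknot_holds

end Literature.Topology.FourManifolds
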